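import Summits.Ventures.LatticeQCDFlow.Scoring.InfiniteVolumeIrreducible2D
import Summits.Ventures.LatticeQCDFlow.Scoring.InfiniteVolumeSUNWilsonLoops2D
import HarnessLib

/-!
# The exact non-abelian area law in two dimensions, V-s: THE EXACT STRING TENSION VANISHES IN THE WEAK-COUPLING LIMIT

HONEST FRAMING: exact (Metropolis-corrected) sampling algorithms for lattice gauge theory;
figures of merit are autocorrelation/cost numbers at stated couplings and volumes; no
continuum-physics claim.

Venture `LatticeQCDFlow` (cell pub-lqcd), sub-topic `Scoring`; FANOUT row 5 (`s0-sun-a`), GEN-19.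
NEW WORK of the cell (placement rule).  V-j/V-l/V-n (`InfiniteVolumeWilsonLoops2D`, `…SUN…`, `…Irreducible2D`)
give the EXACT string tension `σ(β) = −log|P(β)|` of the infinite-volume two-dimensional theory, `P(β)` the
one-plaquette plaquette.  GEN-17 proved `P_N(β) → 1` as `β → ∞` for `U(N)` and `SU(N)`
(`tendsto_unitary_plaquette_atTop`, `tendsto_specialUnitary_plaquette_atTop`) and the general tilted-mean lemma
`tendsto_deriv_cgf_atTop`.  Here (lattice units; the continuum-limit direction `β → ∞`):

* `tendsto_rep_plaquette_atTop` — for EVERY compact metrisable `G`, EVERY continuous `ρ` (`N ≥ 1`):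
  `P_ρ(β) = ∫ (Re tr ρ/N) e^{−β(N − Re tr ρ)} dHaar / ∫ e^{−β(N − Re tr ρ)} dHaar → 1` (Haar measure charges every
  neighbourhood `{Re tr ρ > N − ε}` of the identity);
* **`tendsto_rep_stringTension_atTop`**, **`tendsto_unitary_stringTension_atTop`**,
  **`tendsto_specialUnitary_stringTension_atTop`** — `σ(β) = −log|P(β)| → 0` as `β → ∞` for every continuous `ρ`,
  for `U(N)` (every `N ≥ 1`) and for `SU(N)` (every `N ≥ 1`).

No `def`, nothing cited as a fact, 0 sorry.
-/

noncomputable section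

open MeasureTheory ProbabilityTheory Filter Topology
open Literature.MathematicalPhysics.QuantumFieldTheory
open Literature.RepresentationTheory.CompactGroups

namespace Summit.Ventures.LatticeQCDFlow.Scoring

section General

variable {G : Type*} [Group G] [TopologicalSpace G] [IsTopologicalGroup G]
  [CompactSpace G] [MeasurableSpace G] [BorelSpace G] {N : ℕ} (ρ : G →* Matrix (Fin N) (Fin N) ℂ)

/-- **`P_ρ(β) → 1` AS `β → ∞`, FOR EVERY CONTINUOUS `ρ`** (`N ≥ 1`): the tilted one-plaquette law concentrates at
the identity, where `Re tr ρ = N`, because Haar measure charges every neighbourhood `{Re tr ρ > N − ε}` of `1`. -/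
theorem tendsto_rep_plaquette_atTop [NeZero N] (hρ : Continuous ρ) :
    Tendsto (fun β : ℝ =>
      (∫ g, (ρ g).trace.re / N * Real.exp (-(β * ((N : ℝ) - (ρ g).trace.re))) ∂(haarProbability G)) /
        (∫ g, Real.exp (-(β * ((N : ℝ) - (ρ g).trace.re))) ∂(haarProbability G))) atTop (𝓝 1) := by
  have hN : (N : ℝ) ≠ 0 := Nat.cast_ne_zero.2 (NeZero.ne N)
  have htr : Continuous fun g : G => (ρ g).trace.re := Complex.continuous_re.comp hρ.matrix_trace
  have hle : ∀ g : G, (ρ g).trace.re ≤ N := fun g => (Complex.re_le_norm _).trans (norm_trace_le_card ρ hρ g)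
  have habs : ∀ g : G, |(ρ g).trace.re| ≤ N := fun g =>
    (Complex.abs_re_le_norm _).trans (norm_trace_le_card ρ hρ g)
  have hpos : ∀ ε : ℝ, 0 < ε → 0 < haarProbability G {g | (N : ℝ) - ε < (ρ g).trace.re} := fun ε hε => by
    refine (isOpen_lt continuous_const htr).measure_pos _ ⟨1, ?_⟩
    simp only [Set.mem_setOf_eq, map_one, Matrix.trace_one, Fintype.card_fin, Complex.natCast_re]
    linarith
  have key := tilted_ratio_eq_deriv_cgf (μ := haarProbability G) (M := (N : ℝ)) htr.aestronglyMeasurable habs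
  simp_rw [key]
  have h := (tendsto_deriv_cgf_atTop htr.measurable habs hle hpos).const_mul (1 / (N : ℝ))
  rwa [show 1 / (N : ℝ) * N = 1 by field_simp] at h

/-- **THE EXACT STRING TENSION OF EVERY CONTINUOUS `ρ` VANISHES IN THE WEAK-COUPLING LIMIT** (lattice units):
`σ_ρ(β) = −log|P_ρ(β)| → 0` as `β → ∞` (the value of `irreducible_hasStringTension`). -/
theorem tendsto_rep_stringTension_atTop [NeZero N] (hρ : Continuous ρ) :
    Tendsto (fun β : ℝ =>
      -Real.log |(∫ g, (ρ g).trace.re / N * Real.exp (-(β * ((N : ℝ) - (ρ g).trace.re)))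
          ∂(haarProbability G)) / (∫ g, Real.exp (-(β * ((N : ℝ) - (ρ g).trace.re))) ∂(haarProbability G))|)
      atTop (𝓝 0) := by
  have h := ((tendsto_rep_plaquette_atTop ρ hρ).abs.log (by norm_num)).neg
  simpa using h

end General

/-- **THE EXACT `U(N)` STRING TENSION VANISHES IN THE WEAK-COUPLING LIMIT** (every `N ≥ 1`, lattice units):
`σ_N(β) = −log|P_N(β)| → 0` as `β → ∞` (the value of `unitary_hasStringTension`; GEN-17
`tendsto_unitary_plaquette_atTop`). -/
theorem tendsto_unitary_stringTension_atTop (N : ℕ) [NeZero N] :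
    Tendsto (fun β : ℝ =>
      -Real.log |(∫ u, ((u : Matrix.unitaryGroup (Fin N) ℂ) : Matrix (Fin N) (Fin N) ℂ).trace.re / N *
          Real.exp (-(β * ((N : ℝ) - ((u : Matrix.unitaryGroup (Fin N) ℂ) : Matrix (Fin N) (Fin N) ℂ).trace.re)))
        ∂(haarProbability (Matrix.unitaryGroup (Fin N) ℂ)))
      / (∫ u, Real.exp (-(β * ((N : ℝ) - ((u : Matrix.unitaryGroup (Fin N) ℂ) :
          Matrix (Fin N) (Fin N) ℂ).trace.re))) ∂(haarProbability (Matrix.unitaryGroup (Fin N) ℂ)))|)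
      atTop (𝓝 0) := by
  have h := ((tendsto_unitary_plaquette_atTop N).abs.log (by norm_num)).neg
  simpa using h

/-- **THE EXACT `SU(N)` STRING TENSION VANISHES IN THE WEAK-COUPLING LIMIT** (every `N ≥ 1`, lattice units):
`σ_N(β) = −log|P_N(β)| → 0` as `β → ∞` (the value of `specialUnitary_hasStringTension`; GEN-17
`tendsto_specialUnitary_plaquette_atTop`). -/
theorem tendsto_specialUnitary_stringTension_atTop (N : ℕ) [NeZero N] :
    Tendsto (fun β : ℝ =>
      -Real.log |(∫ u, ((u : Matrix.specialUnitaryGroup (Fin N) ℂ) : Matrix (Fin N) (Fin N) ℂ).trace.re / N *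
          Real.exp (-(β * ((N : ℝ) - ((u : Matrix.specialUnitaryGroup (Fin N) ℂ) :
            Matrix (Fin N) (Fin N) ℂ).trace.re))) ∂(haarProbability (Matrix.specialUnitaryGroup (Fin N) ℂ)))
      / (∫ u, Real.exp (-(β * ((N : ℝ) - ((u : Matrix.specialUnitaryGroup (Fin N) ℂ) :
          Matrix (Fin N) (Fin N) ℂ).trace.re))) ∂(haarProbability (Matrix.specialUnitaryGroup (Fin N) ℂ)))|)
      atTop (𝓝 0) := by
  have h := ((tendsto_specialUnitary_plaquette_atTop N).abs.log (by norm_num)).neg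
  simpa using h

end Summit.Ventures.LatticeQCDFlow.Scoring
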